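import Summits.QuantumFields.GaugeBoot.ZdSchwingerDyson
import Summits.QuantumFields.GaugeBoot.LoopEquationSpectatorPair
import HarnessLib

/-!
# The one-link Schwinger–Dyson identity of a Haar-shift state on `ℤ^d` with ANY NUMBER OF SPECTATOR LOOPS: merge terms, pair form, polarisation (gauge-boot, `ℤ^d` loop equations 5/6)

HONEST FRAMING (cell `pub-gaugeboot`, page 1 of every file): the venture produces certified bounds
on lattice expectations at stated coupling, gauge group, dimension and torus size; NOT a mass gap,
NOT a continuum limit, NOT a string tension; NOT Yang–Mills-summit-bearing (barriers
`FixedCouplingUltralocality`, `PerturbativeInvisibility`).  This file enters no number: it is an exact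
identity for EVERY Haar-shift (in particular every DLR) state of lattice Yang–Mills on the infinite lattice.

## Content

Files 1–4 (`ZdPlaquetteInsertion` … `ZdLoopEquationStates`) give the SINGLE-word loop equation of a
Haar-shift state `μ` on `ℤ^d`.  The finite-`N` bootstrap of Kazakov–Zheng on `ℤ^d` also imposes the
MULTI-TRACE rows ("the variation of `W[C]_{ab} Π_i W[C_i]`", arXiv:2404.16925 §2.3); on the torus these
are `LoopEquationManyWords` (ADDENDUM 25).  This file is their `ℤ^d` / periodic-lattice analogue, part 1:

* `mergeTerm e` — the `k`-th MERGE TERM of a spectator word `v` (from `x₁`) with the marked word `w`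
  (closed at `x`) at the link `(x, μ)` of a periodic lattice `(A, e)`, and its contraction
  `sum_trace_mul_trace_insDeriv_unitDir`, `sum_trace_mul_sum_prod_insDeriv_unitDir` (pointwise algebra,
  verbatim the torus file);
* `sd_pairMany_zd` — for a Haar-shift state `μ` on `ℤ^d`, an admissible direction `X`, any `Y`, a word `w`
  and a finite family of spectator words `(x_a, v_a)_{a ∈ ι}`:
  `∫ (tr(Y·insDeriv_X hol w)·Π_a tr hol v_a + tr(Y ρ(hol w))·Σ_a (Π_{b≠a} tr hol v_b)·tr(insDeriv_X hol v_a)) dμ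
   = β ∫ tr(Y ρ(hol w))·Π_a tr hol v_a·(−½ plaqIns_X) dμ`
  (product rule `HasDerivAt.fun_finsetProd` in `IsHaarShiftState.integral_shiftDeriv_eq`; the test
  function is a cylinder observable);
* `SDPairManyZd` and its polarisation (`…_of_parts/_of_traceless/_of_skew`).
The `SU(N)`/`U(N)` admissibility, the assembled multi-trace loop equation and the DLR / limit-point corollaries
are in `ZdLoopEquationManyWords`.

References: V. Kazakov, Z. Zheng, arXiv:2404.16925 §2.3; S. Chatterjee, CMP 366 (2019) §8.  Everything is `[folklore]`.
-/

noncomputable section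

open MeasureTheory Filter Topology NormedSpace
open scoped Matrix.Norms.Frobenius Matrix
open Literature.Probability.LatticeModels (Site)
open Literature.MathematicalPhysics.QuantumLattice (LGConfig ZdEdge IsCylinder
  fundamentalLatticeRep unitaryFundamentalLatticeRep mem_oneParamGenerators_specialUnitaryGroup
  mem_oneParamGenerators_unitaryGroup)
open Literature.MathematicalPhysics.QuantumFieldTheory (LatticeRep)

namespace Summit.QuantumFields.GaugeBoot

namespace TiltedRP

/-! ### Merge terms on a periodic lattice and their contraction -/
section MergeTerms

variable {A : Type} [AddCommGroup A] [DecidableEq A] {d N : ℕ} {G : Type} [Group G]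
  {ρ : G →* Matrix (Fin N) (Fin N) ℂ} (e : Fin d → A) {ι : Type} [Fintype ι] [DecidableEq ι]

variable (ρ) in
/-- The `k`-th MERGE TERM of the multi-word loop equation at the link `(x, μ)` of the periodic lattice
`(A, e)`: the marked loop `w` (closed at `x`) joined with the spectator `v` (read from `x₁`) at a traversal
of `(x, μ)` by the `k`-th letter of `v` — forward `tr ρ(hol_x w · hol v[k,n) · hol v[0,k)) − (s/N)·tr hol w·tr hol v`,
backward `−(tr ρ(hol_x w · hol v(k,n) · hol v[0,k]) − (s/N)·tr hol w·tr hol v)`, else `0` (weight `s = 1` for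
`SU(N)`, `0` for `U(N)`). [folklore] -/
def mergeTerm (s : ℂ) (x : A) (μ : Fin d) (U : Config A d G) (w : Word d) (x₁ : A) (v : Word d) (k : ℕ) : ℂ :=
  match v[k]? with
  | none => 0
  | some st =>
    if st.link e (Word.siteAt e x₁ v k) = (x, μ) then
      (if st.isFwd then
        (ρ (wordHolonomy e U x w) * (ρ (wordHolonomy e U (Word.siteAt e x₁ v k) (v.drop k)) *
            ρ (wordHolonomy e U x₁ (v.take k)))).trace -
          (s / N) * ((ρ (wordHolonomy e U x w)).trace * (ρ (wordHolonomy e U x₁ v)).trace)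
      else
        -((ρ (wordHolonomy e U x w) * (ρ (wordHolonomy e U (Word.siteAt e x₁ v (k + 1)) (v.drop (k + 1))) *
            ρ (wordHolonomy e U x₁ (v.take (k + 1))))).trace -
          (s / N) * ((ρ (wordHolonomy e U x w)).trace * (ρ (wordHolonomy e U x₁ v)).trace)))
    else 0

omit [DecidableEq A] in
/-- The trace of the re-based spectator: `tr(ρ(hol v[k,n))·ρ(hol v[0,k))) = tr ρ(hol v)`. [folklore] -/
theorem trace_drop_mul_take (U : Config A d G) (x₁ : A) (v : Word d) (k : ℕ) :
    (ρ (wordHolonomy e U (Word.siteAt e x₁ v k) (v.drop k)) * ρ (wordHolonomy e U x₁ (v.take k))).trace =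
      (ρ (wordHolonomy e U x₁ v)).trace := by
  rw [Matrix.trace_mul_comm, ← map_mul, wordHolonomy_take_drop]

/-- **Merge contraction**: `Σ_ij tr(E_ji ρ(hol w))·occTerm_k(X_ij, Y = 1; v) = mergeTerm_k(w, v)`. [folklore] -/
theorem sum_trace_mul_occTerm_unitDir (s : ℂ) (x : A) (μ : Fin d) (U : Config A d G) (w : Word d) (x₁ : A)
    (v : Word d) (k : ℕ) :
    ∑ i : Fin N, ∑ j : Fin N, (Matrix.single j i (1 : ℂ) * ρ (wordHolonomy e U x w)).trace *
        occTerm ρ e (x, μ) (unitDir s i j) 1 U x₁ v k = mergeTerm ρ e s x μ U w x₁ v k := by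
  unfold occTerm mergeTerm
  cases v[k]? with
  | none => simp
  | some st =>
    simp only
    split_ifs
    · simp only [Matrix.one_mul, trace_sandwich_cycle _ (unitDir s _ _), sum_trace_mul_trace_unitDir,
        trace_drop_mul_take]
    · simp only [Matrix.one_mul, trace_sandwich_cycle _ (unitDir s _ _), mul_neg, Finset.sum_neg_distrib,
        sum_trace_mul_trace_unitDir, trace_drop_mul_take]
    · simp

/-- **Contracted merge side, pointwise**: `Σ_ij tr(E_ji ρ(hol w))·tr(insDeriv_{X_ij} hol v) = Σ_{k'} mergeTerm_{k'}`.
[folklore] -/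
theorem sum_trace_mul_trace_insDeriv_unitDir (s : ℂ) (x : A) (μ : Fin d) (U : Config A d G) (w : Word d)
    (x₁ : A) (v : Word d) :
    ∑ i : Fin N, ∑ j : Fin N, (Matrix.single j i (1 : ℂ) * ρ (wordHolonomy e U x w)).trace *
        (insDeriv ρ e (x, μ) (unitDir s i j) U x₁ v).trace =
      ∑ k ∈ Finset.range v.length, mergeTerm ρ e s x μ U w x₁ v k := by
  have h1 : ∀ i j : Fin N, (insDeriv ρ e (x, μ) (unitDir s i j) U x₁ v).trace =
      ∑ k ∈ Finset.range v.length, occTerm ρ e (x, μ) (unitDir s i j) 1 U x₁ v k := fun i j => by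
    rw [← trace_mul_insDeriv, Matrix.one_mul]
  simp only [h1, Finset.mul_sum]
  calc ∑ i : Fin N, ∑ j : Fin N, ∑ k ∈ Finset.range v.length,
        (Matrix.single j i (1 : ℂ) * ρ (wordHolonomy e U x w)).trace * occTerm ρ e (x, μ) (unitDir s i j) 1 U x₁ v k
      = ∑ i : Fin N, ∑ k ∈ Finset.range v.length, ∑ j : Fin N,
        (Matrix.single j i (1 : ℂ) * ρ (wordHolonomy e U x w)).trace * occTerm ρ e (x, μ) (unitDir s i j) 1 U x₁ v k :=
        Finset.sum_congr rfl fun _ _ => Finset.sum_comm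
    _ = ∑ k ∈ Finset.range v.length, ∑ i : Fin N, ∑ j : Fin N,
        (Matrix.single j i (1 : ℂ) * ρ (wordHolonomy e U x w)).trace * occTerm ρ e (x, μ) (unitDir s i j) 1 U x₁ v k :=
        Finset.sum_comm
    _ = ∑ k ∈ Finset.range v.length, mergeTerm ρ e s x μ U w x₁ v k :=
        Finset.sum_congr rfl fun k _ => sum_trace_mul_occTerm_unitDir e s x μ U w x₁ v k

/-- **Merge contraction for a family of spectators**: `Σ_ij tr(E_ji ρ(hol w))·Σ_a (Π_{b≠a} tr hol v_b)·tr(insDeriv_{X_ij} hol v_a)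
= Σ_a (Π_{b≠a} tr hol v_b)·Σ_{k'} mergeTerm_{k'}(w, v_a)`. [folklore] -/
theorem sum_trace_mul_sum_prod_insDeriv_unitDir (s : ℂ) (x : A) (μ : Fin d) (U : Config A d G) (w : Word d)
    (xs : ι → A) (vs : ι → Word d) :
    ∑ i : Fin N, ∑ j : Fin N, (Matrix.single j i (1 : ℂ) * ρ (wordHolonomy e U x w)).trace *
        ∑ a, (∏ b ∈ Finset.univ.erase a, (ρ (wordHolonomy e U (xs b) (vs b))).trace) *
          (insDeriv ρ e (x, μ) (unitDir s i j) U (xs a) (vs a)).trace =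
      ∑ a, (∏ b ∈ Finset.univ.erase a, (ρ (wordHolonomy e U (xs b) (vs b))).trace) *
        ∑ k ∈ Finset.range (vs a).length, mergeTerm ρ e s x μ U w (xs a) (vs a) k := by
  calc ∑ i : Fin N, ∑ j : Fin N, (Matrix.single j i (1 : ℂ) * ρ (wordHolonomy e U x w)).trace *
        ∑ a, (∏ b ∈ Finset.univ.erase a, (ρ (wordHolonomy e U (xs b) (vs b))).trace) *
          (insDeriv ρ e (x, μ) (unitDir s i j) U (xs a) (vs a)).trace
      = ∑ i : Fin N, ∑ j : Fin N, ∑ a, (Matrix.single j i (1 : ℂ) * ρ (wordHolonomy e U x w)).trace *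
        ((∏ b ∈ Finset.univ.erase a, (ρ (wordHolonomy e U (xs b) (vs b))).trace) *
          (insDeriv ρ e (x, μ) (unitDir s i j) U (xs a) (vs a)).trace) := by simp only [Finset.mul_sum]
    _ = ∑ i : Fin N, ∑ a, ∑ j : Fin N, (Matrix.single j i (1 : ℂ) * ρ (wordHolonomy e U x w)).trace *
        ((∏ b ∈ Finset.univ.erase a, (ρ (wordHolonomy e U (xs b) (vs b))).trace) *
          (insDeriv ρ e (x, μ) (unitDir s i j) U (xs a) (vs a)).trace) :=
        Finset.sum_congr rfl fun _ _ => Finset.sum_comm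
    _ = ∑ a, ∑ i : Fin N, ∑ j : Fin N, (Matrix.single j i (1 : ℂ) * ρ (wordHolonomy e U x w)).trace *
        ((∏ b ∈ Finset.univ.erase a, (ρ (wordHolonomy e U (xs b) (vs b))).trace) *
          (insDeriv ρ e (x, μ) (unitDir s i j) U (xs a) (vs a)).trace) := Finset.sum_comm
    _ = ∑ a, (∏ b ∈ Finset.univ.erase a, (ρ (wordHolonomy e U (xs b) (vs b))).trace) *
        ∑ i : Fin N, ∑ j : Fin N, (Matrix.single j i (1 : ℂ) * ρ (wordHolonomy e U x w)).trace *
          (insDeriv ρ e (x, μ) (unitDir s i j) U (xs a) (vs a)).trace := by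
        refine Finset.sum_congr rfl fun a _ => ?_
        rw [Finset.mul_sum]
        refine Finset.sum_congr rfl fun i _ => ?_
        rw [Finset.mul_sum]
        exact Finset.sum_congr rfl fun j _ => by ring
    _ = ∑ a, (∏ b ∈ Finset.univ.erase a, (ρ (wordHolonomy e U (xs b) (vs b))).trace) *
        ∑ k ∈ Finset.range (vs a).length, mergeTerm ρ e s x μ U w (xs a) (vs a) k :=
        Finset.sum_congr rfl fun a _ => by rw [sum_trace_mul_trace_insDeriv_unitDir e s x μ U w (xs a) (vs a)]

omit [Fintype ι] [DecidableEq ι] in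
/-- Linearity of the spectator-derivative sum in the direction. [folklore] -/
theorem sum_prod_insDeriv_add_smul (S : Finset ι) (T : ι → Finset ι) (x : A) (μ : Fin d) (U : Config A d G)
    (xs : ι → A) (vs : ι → Word d) (X₁ X₂ : Matrix (Fin N) (Fin N) ℂ) (c : ℂ) :
    ∑ a ∈ S, (∏ b ∈ T a, (ρ (wordHolonomy e U (xs b) (vs b))).trace) *
        (insDeriv ρ e (x, μ) (X₁ + c • X₂) U (xs a) (vs a)).trace =
      (∑ a ∈ S, (∏ b ∈ T a, (ρ (wordHolonomy e U (xs b) (vs b))).trace) * (insDeriv ρ e (x, μ) X₁ U (xs a) (vs a)).trace) +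
        c * ∑ a ∈ S, (∏ b ∈ T a, (ρ (wordHolonomy e U (xs b) (vs b))).trace) *
          (insDeriv ρ e (x, μ) X₂ U (xs a) (vs a)).trace := by
  rw [Finset.mul_sum, ← Finset.sum_add_distrib]
  refine Finset.sum_congr rfl fun a _ => ?_
  rw [insDeriv_add, insDeriv_smul, Matrix.trace_add, Matrix.trace_smul, smul_eq_mul]
  ring

variable [TopologicalSpace G] [IsTopologicalGroup G] (r : LatticeRep G)

omit [DecidableEq ι] [Fintype ι] in
/-- Continuity of the merge terms. [folklore] -/
theorem continuous_mergeTerm (s : ℂ) (x : A) (μ : Fin d) (w : Word d) (x₁ : A) (v : Word d) (k : ℕ) :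
    Continuous fun U : Config A d G => mergeTerm r.ρ e s x μ U w x₁ v k := by
  unfold mergeTerm
  cases v[k]? with
  | none => exact continuous_const
  | some st =>
    simp only
    split_ifs
    · exact (((r.continuous.comp (continuous_wordHolonomy e x w)).mul
          ((r.continuous.comp (continuous_wordHolonomy e _ _)).mul
            (r.continuous.comp (continuous_wordHolonomy e x₁ _)))).matrix_trace).sub
        (continuous_const.mul ((continuous_trace_wordHolonomy e r x w).mul (continuous_trace_wordHolonomy e r x₁ v)))
    · exact ((((r.continuous.comp (continuous_wordHolonomy e x w)).mul
          ((r.continuous.comp (continuous_wordHolonomy e _ _)).mul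
            (r.continuous.comp (continuous_wordHolonomy e x₁ _)))).matrix_trace).sub
        (continuous_const.mul ((continuous_trace_wordHolonomy e r x w).mul
          (continuous_trace_wordHolonomy e r x₁ v)))).neg
    · exact continuous_const

omit [DecidableEq ι] in
/-- Continuity of the left integrand of the many-spectator identity (periodic lattice). [folklore] -/
theorem continuous_lhsMany (Y X : Matrix (Fin r.N) (Fin r.N) ℂ) (x : A) (μ : Fin d) (x₀ : A) (w : Word d)
    (xs : ι → A) (vs : ι → Word d) (T : ι → Finset ι) :
    Continuous fun U : Config A d G =>
      (Y * insDeriv r.ρ e (x, μ) X U x₀ w).trace * (∏ a, (r.ρ (wordHolonomy e U (xs a) (vs a))).trace) +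
        (Y * r.ρ (wordHolonomy e U x₀ w)).trace *
          ∑ a, (∏ b ∈ T a, (r.ρ (wordHolonomy e U (xs b) (vs b))).trace) *
            (insDeriv r.ρ e (x, μ) X U (xs a) (vs a)).trace := by
  have h1 : Continuous fun U : Config A d G => (Y * insDeriv r.ρ e (x, μ) X U x₀ w).trace :=
    (continuous_const.mul (continuous_insDeriv e (x, μ) r.continuous x₀ w)).matrix_trace
  have h2 : Continuous fun U : Config A d G => ∏ a, (r.ρ (wordHolonomy e U (xs a) (vs a))).trace :=
    continuous_finsetProd _ fun a _ => continuous_trace_wordHolonomy e r (xs a) (vs a)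
  have h3 : Continuous fun U : Config A d G => (Y * r.ρ (wordHolonomy e U x₀ w)).trace :=
    (continuous_const.mul (r.continuous.comp (continuous_wordHolonomy e x₀ w))).matrix_trace
  have h4 : Continuous fun U : Config A d G =>
      ∑ a, (∏ b ∈ T a, (r.ρ (wordHolonomy e U (xs b) (vs b))).trace) * (insDeriv r.ρ e (x, μ) X U (xs a) (vs a)).trace :=
    continuous_finsetSum _ fun a _ =>
      (continuous_finsetProd _ fun b _ => continuous_trace_wordHolonomy e r (xs b) (vs b)).mul
        (continuous_insDeriv e (x, μ) r.continuous (xs a) (vs a)).matrix_trace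
  exact (h1.mul h2).add (h3.mul h4)

omit [DecidableEq A] [DecidableEq ι] in
/-- Continuity of the right integrand of the many-spectator identity (periodic lattice). [folklore] -/
theorem continuous_rhsMany (Y X : Matrix (Fin r.N) (Fin r.N) ℂ) (x : A) (μ : Fin d) (x₀ : A) (w : Word d)
    (xs : ι → A) (vs : ι → Word d) :
    Continuous fun U : Config A d G =>
      (Y * r.ρ (wordHolonomy e U x₀ w)).trace * (∏ a, (r.ρ (wordHolonomy e U (xs a) (vs a))).trace) *
        (-(1 / 2) * plaqIns r.ρ e X U x μ) :=
  (((continuous_const.mul (r.continuous.comp (continuous_wordHolonomy e x₀ w))).matrix_trace).mul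
    (continuous_finsetProd _ fun a _ => continuous_trace_wordHolonomy e r (xs a) (vs a))).mul
    (continuous_const.mul (continuous_plaqIns r e X x μ))

end MergeTerms

/-! ### The identity for a Haar-shift state on `ℤ^d` -/

section SDPairMany

variable {d N : ℕ} {G : Type} [Group G] [TopologicalSpace G] [IsTopologicalGroup G] [CompactSpace G]
  [MeasurableSpace G] [BorelSpace G] {ι : Type} [Fintype ι] [DecidableEq ι]
  (μW : Measure (LGConfig d G)) (r : LatticeRep G)

omit [IsTopologicalGroup G] [CompactSpace G] [MeasurableSpace G] [BorelSpace G] [DecidableEq ι] in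
/-- The multi-loop test function `tr(Y ρ(hol w))·Π_a tr ρ(hol v_a)` is a cylinder observable on `ℤ^d`. [folklore] -/
theorem exists_isCylinder_multiLoop (Y : Matrix (Fin r.N) (Fin r.N) ℂ) (x₀ : Site d) (w : Word d)
    (xs : ι → Site d) (vs : ι → Word d) :
    ∃ T₀ : Finset (ZdEdge d), IsCylinder (fun U : LGConfig d G =>
      (Y * r.ρ (wordHolonomy (zdUnit d) U x₀ w)).trace * ∏ a, (r.ρ (wordHolonomy (zdUnit d) U (xs a) (vs a))).trace) T₀ := by
  classical
  obtain ⟨Tw, hTw⟩ := exists_isCylinder_wordHolonomy_zdUnit (G := G) x₀ w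
  choose T hT using fun a => exists_isCylinder_wordHolonomy_zdUnit (G := G) (xs a) (vs a)
  refine ⟨Tw ∪ Finset.univ.biUnion T, fun U V hUV => ?_⟩
  have hw : wordHolonomy (zdUnit d) U x₀ w = wordHolonomy (zdUnit d) V x₀ w :=
    hTw (fun l hl => hUV l (by simp only [Finset.coe_union, Finset.coe_biUnion, Finset.coe_univ, Set.mem_univ,
      Set.iUnion_true, Set.mem_union, Finset.mem_coe, Set.mem_iUnion] ; exact Or.inl hl))
  have hv : ∀ a, wordHolonomy (zdUnit d) U (xs a) (vs a) = wordHolonomy (zdUnit d) V (xs a) (vs a) := fun a =>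
    hT a (fun l hl => hUV l (by simp only [Finset.coe_union, Finset.coe_biUnion, Finset.coe_univ, Set.mem_univ,
      Set.iUnion_true, Set.mem_union, Finset.mem_coe, Set.mem_iUnion]; exact Or.inr ⟨a, hl⟩))
  simp only [hw, hv]

/-- **The one-link Schwinger–Dyson identity with a finite family of spectator loops, for a Haar-shift state
on `ℤ^d` (pair form).**  For an admissible direction `X` (skew-Hermitian, `r.ρ(k t) = exp(tX)`), ANY matrix
`Y`, a word `w` from `x₀`, spectator words `v_a` from `x_a` (`a ∈ ι` finite) and the link `(x, μ)`:
`∫ (tr(Y·insDeriv_X hol w)·Π_a tr hol v_a + tr(Y ρ(hol w))·Σ_a (Π_{b≠a} tr hol v_b)·tr(insDeriv_X hol v_a)) dμ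
 = β ∫ tr(Y ρ(hol w))·Π_a tr hol v_a·(−½ plaqIns_X) dμ`. [folklore] -/
theorem sd_pairMany_zd {β : ℝ} [IsFiniteMeasure μW] (hμ : IsHaarShiftState r.ρ β μW) (x : Site d) (μ : Fin d)
    {k : ℝ → G} (hk : ∀ s t, k (s + t) = k s * k t) {X : Matrix (Fin r.N) (Fin r.N) ℂ}
    (hX : ∀ t, r.ρ (k t) = exp ((t : ℂ) • X)) (hXs : Xᴴ = -X) (Y : Matrix (Fin r.N) (Fin r.N) ℂ) (x₀ : Site d)
    (w : Word d) (xs : ι → Site d) (vs : ι → Word d) :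
    ∫ U, ((Y * insDeriv r.ρ (zdUnit d) (x, μ) X U x₀ w).trace *
          (∏ a, (r.ρ (wordHolonomy (zdUnit d) U (xs a) (vs a))).trace) +
        (Y * r.ρ (wordHolonomy (zdUnit d) U x₀ w)).trace *
          ∑ a, (∏ b ∈ Finset.univ.erase a, (r.ρ (wordHolonomy (zdUnit d) U (xs b) (vs b))).trace) *
            (insDeriv r.ρ (zdUnit d) (x, μ) X U (xs a) (vs a)).trace) ∂μW =
      (β : ℂ) * ∫ U, (Y * r.ρ (wordHolonomy (zdUnit d) U x₀ w)).trace *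
        (∏ a, (r.ρ (wordHolonomy (zdUnit d) U (xs a) (vs a))).trace) * (-(1 / 2) * plaqIns r.ρ (zdUnit d) X U x μ) ∂μW := by
  obtain ⟨T₀, hT₀⟩ := exists_isCylinder_multiLoop r Y x₀ w xs vs
  have h := integral_shiftDeriv_eq_complex r hμ (x, μ) hk
    (fun U => (Y * r.ρ (wordHolonomy (zdUnit d) U x₀ w)).trace * ∏ a, (r.ρ (wordHolonomy (zdUnit d) U (xs a) (vs a))).trace)
    (fun U => (Y * insDeriv r.ρ (zdUnit d) (x, μ) X U x₀ w).trace *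
          (∏ a, (r.ρ (wordHolonomy (zdUnit d) U (xs a) (vs a))).trace) +
        (Y * r.ρ (wordHolonomy (zdUnit d) U x₀ w)).trace *
          ∑ a, (∏ b ∈ Finset.univ.erase a, (r.ρ (wordHolonomy (zdUnit d) U (xs b) (vs b))).trace) *
            (insDeriv r.ρ (zdUnit d) (x, μ) X U (xs a) (vs a)).trace) (T₀ := T₀) hT₀
    (((continuous_const.mul (r.continuous.comp (continuous_wordHolonomy (zdUnit d) x₀ w))).matrix_trace).mul
      (continuous_finsetProd _ fun a _ => continuous_trace_wordHolonomy (zdUnit d) r (xs a) (vs a)))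
    (continuous_lhsMany (zdUnit d) r Y X x μ x₀ w xs vs _)
    (fun U => by
      have h1 : HasDerivAt (fun t : ℝ => (Y * r.ρ (wordHolonomy (zdUnit d) (Function.update U (x, μ) (k t * U (x, μ))) x₀ w)).trace)
          ((Y * insDeriv r.ρ (zdUnit d) (x, μ) X U x₀ w).trace) 0 := by
        have hd := (traceMulLeftCLM Y).hasFDerivAt.comp_hasDerivAt (0 : ℝ)
          (hasDerivAt_wordHolonomy (zdUnit d) (x, μ) hk hX U x₀ w)
        simpa [Function.comp_def] using hd.congr_deriv (traceMulLeftCLM_apply Y _)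
      have h2 : ∀ a ∈ (Finset.univ : Finset ι), HasDerivAt
          (fun t : ℝ => (r.ρ (wordHolonomy (zdUnit d) (Function.update U (x, μ) (k t * U (x, μ))) (xs a) (vs a))).trace)
          ((insDeriv r.ρ (zdUnit d) (x, μ) X U (xs a) (vs a)).trace) 0 := fun a _ => by
        have hd := (traceMulLeftCLM (1 : Matrix (Fin r.N) (Fin r.N) ℂ)).hasFDerivAt.comp_hasDerivAt (0 : ℝ)
          (hasDerivAt_wordHolonomy (zdUnit d) (x, μ) hk hX U (xs a) (vs a))
        simpa [Function.comp_def, Matrix.one_mul] using hd.congr_deriv (traceMulLeftCLM_apply 1 _)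
      have h12 := h1.mul (HasDerivAt.fun_finsetProd h2)
      simp only [update_shift_zero hk, smul_eq_mul] at h12
      exact h12)
    (actionDerivZd r.ρ (x, μ) X) (continuous_actionDerivZd (x, μ) r.continuous)
    (fun U => hasDerivAt_wilsonBoundaryAction (x, μ) hk hX U)
  rw [h]
  congr 1
  refine integral_congr_ae (ae_of_all _ fun U => ?_)
  simp only [actionDerivZd_eq_plaqIns hXs r.mem_unitary U x μ]

/-- THE MANY-SPECTATOR PAIR IDENTITY for the direction `X` and a measure `μ` on `ℤ^d` configurations (marked
word `w` from `x₀`, spectators `(x_a, v_a)`, link `(x, μ)`, coupling `β`), as a predicate in `X` (used to organise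
polarisation — not a named fact). [folklore] -/
def SDPairManyZd (β : ℝ) (x : Site d) (μ : Fin d) (x₀ : Site d) (w : Word d) (xs : ι → Site d) (vs : ι → Word d)
    (X : Matrix (Fin r.N) (Fin r.N) ℂ) : Prop :=
  ∀ Y : Matrix (Fin r.N) (Fin r.N) ℂ,
    ∫ U, ((Y * insDeriv r.ρ (zdUnit d) (x, μ) X U x₀ w).trace *
          (∏ a, (r.ρ (wordHolonomy (zdUnit d) U (xs a) (vs a))).trace) +
        (Y * r.ρ (wordHolonomy (zdUnit d) U x₀ w)).trace *
          ∑ a, (∏ b ∈ Finset.univ.erase a, (r.ρ (wordHolonomy (zdUnit d) U (xs b) (vs b))).trace) *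
            (insDeriv r.ρ (zdUnit d) (x, μ) X U (xs a) (vs a)).trace) ∂μW =
      (β : ℂ) * ∫ U, (Y * r.ρ (wordHolonomy (zdUnit d) U x₀ w)).trace *
        (∏ a, (r.ρ (wordHolonomy (zdUnit d) U (xs a) (vs a))).trace) * (-(1 / 2) * plaqIns r.ρ (zdUnit d) X U x μ) ∂μW

variable {μW}

/-- `sd_pairMany_zd` restated: for a Haar-shift state, admissible skew-Hermitian directions satisfy the
many-spectator pair identity. [folklore] -/
theorem sdPairManyZd_of_oneParam [IsFiniteMeasure μW] {β : ℝ} (hμ : IsHaarShiftState r.ρ β μW) (x : Site d)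
    (μ : Fin d) (x₀ : Site d) (w : Word d) (xs : ι → Site d) (vs : ι → Word d) {X : Matrix (Fin r.N) (Fin r.N) ℂ}
    (hXs : Xᴴ = -X) {k : ℝ → G} (hk : ∀ s t, k (s + t) = k s * k t) (hX : ∀ t, r.ρ (k t) = exp ((t : ℂ) • X)) :
    SDPairManyZd μW r β x μ x₀ w xs vs X :=
  fun Y => sd_pairMany_zd μW r hμ x μ hk hX hXs Y x₀ w xs vs

/-- **Polarisation step** for the many-spectator identity on `ℤ^d` (both sides are `ℂ`-linear in `X`).
[folklore] -/
theorem sdPairManyZd_of_parts [IsFiniteMeasure μW] (β : ℝ) (x : Site d) (μ : Fin d) (x₀ : Site d) (w : Word d)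
    (xs : ι → Site d) (vs : ι → Word d) (X : Matrix (Fin r.N) (Fin r.N) ℂ)
    (hPA : SDPairManyZd μW r β x μ x₀ w xs vs ((1 / 2 : ℂ) • (X - Xᴴ)))
    (hPB : SDPairManyZd μW r β x μ x₀ w xs vs ((Complex.I / 2) • (X + Xᴴ))) : SDPairManyZd μW r β x μ x₀ w xs vs X := by
  set A₁ : Matrix (Fin r.N) (Fin r.N) ℂ := (1 / 2 : ℂ) • (X - Xᴴ) with hA
  set B₁ : Matrix (Fin r.N) (Fin r.N) ℂ := (Complex.I / 2) • (X + Xᴴ) with hB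
  have hXAB : X = A₁ + (-Complex.I) • B₁ := eq_skewPart_add X
  clear_value A₁ B₁
  intro Y
  have hiA := integrable_of_continuous_zd r μW (continuous_lhsMany (zdUnit d) r Y A₁ x μ x₀ w xs vs (Finset.univ.erase ·))
  have hiB := integrable_of_continuous_zd r μW (continuous_lhsMany (zdUnit d) r Y B₁ x μ x₀ w xs vs (Finset.univ.erase ·))
  have hjA := integrable_of_continuous_zd r μW (continuous_rhsMany (zdUnit d) r Y A₁ x μ x₀ w xs vs)
  have hjB := integrable_of_continuous_zd r μW (continuous_rhsMany (zdUnit d) r Y B₁ x μ x₀ w xs vs)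
  have hl : ∀ U : LGConfig d G,
      (Y * insDeriv r.ρ (zdUnit d) (x, μ) X U x₀ w).trace * (∏ a, (r.ρ (wordHolonomy (zdUnit d) U (xs a) (vs a))).trace) +
          (Y * r.ρ (wordHolonomy (zdUnit d) U x₀ w)).trace *
            ∑ a, (∏ b ∈ Finset.univ.erase a, (r.ρ (wordHolonomy (zdUnit d) U (xs b) (vs b))).trace) *
              (insDeriv r.ρ (zdUnit d) (x, μ) X U (xs a) (vs a)).trace =
        ((Y * insDeriv r.ρ (zdUnit d) (x, μ) A₁ U x₀ w).trace * (∏ a, (r.ρ (wordHolonomy (zdUnit d) U (xs a) (vs a))).trace) +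
            (Y * r.ρ (wordHolonomy (zdUnit d) U x₀ w)).trace *
              ∑ a, (∏ b ∈ Finset.univ.erase a, (r.ρ (wordHolonomy (zdUnit d) U (xs b) (vs b))).trace) *
                (insDeriv r.ρ (zdUnit d) (x, μ) A₁ U (xs a) (vs a)).trace) +
          (-Complex.I) * ((Y * insDeriv r.ρ (zdUnit d) (x, μ) B₁ U x₀ w).trace *
              (∏ a, (r.ρ (wordHolonomy (zdUnit d) U (xs a) (vs a))).trace) +
            (Y * r.ρ (wordHolonomy (zdUnit d) U x₀ w)).trace *
              ∑ a, (∏ b ∈ Finset.univ.erase a, (r.ρ (wordHolonomy (zdUnit d) U (xs b) (vs b))).trace) *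
                (insDeriv r.ρ (zdUnit d) (x, μ) B₁ U (xs a) (vs a)).trace) := by
    intro U
    rw [hXAB, sum_prod_insDeriv_add_smul, insDeriv_add, insDeriv_smul, Matrix.mul_add, Matrix.mul_smul, Matrix.trace_add,
      Matrix.trace_smul, smul_eq_mul]
    ring
  have hr : ∀ U : LGConfig d G,
      (Y * r.ρ (wordHolonomy (zdUnit d) U x₀ w)).trace * (∏ a, (r.ρ (wordHolonomy (zdUnit d) U (xs a) (vs a))).trace) *
          (-(1 / 2) * plaqIns r.ρ (zdUnit d) X U x μ) =
        (Y * r.ρ (wordHolonomy (zdUnit d) U x₀ w)).trace * (∏ a, (r.ρ (wordHolonomy (zdUnit d) U (xs a) (vs a))).trace) *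
            (-(1 / 2) * plaqIns r.ρ (zdUnit d) A₁ U x μ) +
          (-Complex.I) * ((Y * r.ρ (wordHolonomy (zdUnit d) U x₀ w)).trace *
            (∏ a, (r.ρ (wordHolonomy (zdUnit d) U (xs a) (vs a))).trace) * (-(1 / 2) * plaqIns r.ρ (zdUnit d) B₁ U x μ)) := by
    intro U
    rw [hXAB, plaqIns_add, plaqIns_smul]
    ring
  simp_rw [hl, hr]
  rw [integral_add hiA (hiB.const_mul _), integral_const_mul, integral_add hjA (hjB.const_mul _), integral_const_mul,
    hPA Y, hPB Y]
  ring

/-- **Polarisation (`𝔰𝔲`-type)** for the many-spectator identity on `ℤ^d`. [folklore] -/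
theorem sdPairManyZd_of_traceless [IsFiniteMeasure μW] (β : ℝ) (x : Site d) (μ : Fin d) (x₀ : Site d) (w : Word d)
    (xs : ι → Site d) (vs : ι → Word d)
    (hadm : ∀ X : Matrix (Fin r.N) (Fin r.N) ℂ, Xᴴ = -X → X.trace = 0 → SDPairManyZd μW r β x μ x₀ w xs vs X)
    (X : Matrix (Fin r.N) (Fin r.N) ℂ) (hX : X.trace = 0) : SDPairManyZd μW r β x μ x₀ w xs vs X :=
  sdPairManyZd_of_parts r β x μ x₀ w xs vs X (hadm _ (conjTranspose_skewPart X) (trace_parts_eq_zero hX _).1)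
    (hadm _ (conjTranspose_iHermPart X) (trace_parts_eq_zero hX _).2)

/-- **Polarisation (`𝔲`-type)** for the many-spectator identity on `ℤ^d`. [folklore] -/
theorem sdPairManyZd_of_skew [IsFiniteMeasure μW] (β : ℝ) (x : Site d) (μ : Fin d) (x₀ : Site d) (w : Word d)
    (xs : ι → Site d) (vs : ι → Word d)
    (hadm : ∀ X : Matrix (Fin r.N) (Fin r.N) ℂ, Xᴴ = -X → SDPairManyZd μW r β x μ x₀ w xs vs X)
    (X : Matrix (Fin r.N) (Fin r.N) ℂ) : SDPairManyZd μW r β x μ x₀ w xs vs X :=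
  sdPairManyZd_of_parts r β x μ x₀ w xs vs X (hadm _ (conjTranspose_skewPart X)) (hadm _ (conjTranspose_iHermPart X))

end SDPairMany

end TiltedRP

end Summit.QuantumFields.GaugeBoot

end
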